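import Summits.HubbardSuperconductivity.HubbardSuperconductivity.Theorems.TwSourcedCondensation.Negative.StrengtheningsRefuted

/-!
# Crux `TwSourcedCondensation` (item `stmt-HubbardSuperconductivity-1697`): decorative hypotheses,
normal forms, and the frozen-threshold obstruction

Support file of the standing disprover (generation 2); no definition is introduced (the sourced torus
pressure `p̃_L(h) = log Re Z_β(dWaveSourceTorus L U μ h)/(βL²)` is spelled out). Proved:

* `twSourcedCondensation_iff_core` — the coupling ceiling `U ≤ U₀` and the source window
  `|h| ≤ h₀` are DECORATIVE: the crux is equivalent to its three-constant core
  `∀[μ₁,μ₂] ∃ a c C > 0 ∀U>0 ∀β∈[1,e^{a/U}] ∀μ ∃L₀ ∀L≥L₀ ∀h∈ℝ: c h² log(1/(|h|+1/β)) - C h² ≤ p̃_L(h) - p̃_L(0)`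
  (trade `U₀, h₀` for `C' = C + c·a/U₀ + c|log h₀|`, using `RHS ≥ 0`).
* `twSourcedCondensation_iff_pos` — by evenness only POSITIVE sources `0 < h ≤ h₀` matter.
* `twSourcedCondensation_shape_at_c_zero` — with the Cooper coefficient `c = 0` the inequality is a
  triviality (`RHS ≥ 0`): all content is in `0 < c`.
* `twSourcedCondensation_false_frozenThreshold_of_gap` — the THRESHOLD `L₀ = L₀(U,β,μ)` cannot be
  frozen at any side `ℓ` whose cluster `hubbardTorusWith 2 ℓ 1 U μs` has, for small `U`, a unique
  gapped ground vector orthogonal to its pair-source image (an explicit finite-dimensional spectral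
  hypothesis, stated inline; e.g. `ℓ = 2`, `μs = -1/2`): witness `L = ℓ`, `β = e^{a/U}`,
  `h = β^{-1/2}`, via the `β`-uniform gapped bound of `FiniteVolumeResponseBounds`. So `L₀ → ∞` as
  `β → ∞` is forced off resonance (mirror image of the resonant-shell obstruction for the sibling
  crux `TwSourcedInertness`).

A prover may therefore assume `0 < h ≤ h₀`, pick `U₀`, `h₀` freely, and must let `L₀` grow with `β`.
-/

noncomputable section

namespace Summit.HubbardSuperconductivity.HubbardSuperconductivity.Theorems.TwSourcedCondensation.Negative

open Matrix Finset Literature.MathematicalPhysics.QuantumLattice Literature.Probability.LatticeModels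
open Summit.HubbardSuperconductivity.HubbardSuperconductivity.Theses.ThermalWedge
open scoped Matrix.Norms.L2Operator ComplexOrder

/-! ### Elementary facts about the cutoff logarithm -/

/-- The cutoff logarithm is at most `log β` (`β > 0`). [folklore] -/
theorem log_cutoff_le_log {β : ℝ} (hβ : 0 < β) (h : ℝ) :
    Real.log (1 / (|h| + 1 / β)) ≤ Real.log β := by
  have hpos : 0 < |h| + 1 / β := by positivity
  refine Real.log_le_log (by positivity) ?_
  rw [div_le_iff₀ hpos]
  have : β * (1 / β) = 1 := mul_one_div_cancel hβ.ne'
  nlinarith [abs_nonneg h]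

/-- Outside the window `|h| ≤ h₀` the cutoff logarithm is at most `|log h₀|` (`β > 0`). [folklore] -/
theorem log_cutoff_le_of_lt {β h₀ : ℝ} (hβ : 0 < β) (hh₀ : 0 < h₀) {h : ℝ} (hh : h₀ < |h|) :
    Real.log (1 / (|h| + 1 / β)) ≤ |Real.log h₀| := by
  have hpos : 0 < |h| + 1 / β := by positivity
  calc Real.log (1 / (|h| + 1 / β)) ≤ Real.log (1 / h₀) := by
        refine Real.log_le_log (by positivity) (one_div_le_one_div_of_le hh₀ ?_)
        linarith [one_div_pos.2 hβ]
    _ ≤ |Real.log h₀| := by rw [one_div, Real.log_inv]; exact neg_le_abs _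

/-! ### `U ≤ U₀` and `|h| ≤ h₀` are decorative -/

/-- **`TwSourcedCondensation` ↔ its three-constant core** (no `U₀`, no `h₀`; all `U > 0`, all real
`h`): outside `U ≤ U₀` one has `log(1/(|h|+1/β)) ≤ log β ≤ a/U < a/U₀`, outside `|h| ≤ h₀` one has
`log(1/(|h|+1/β)) ≤ |log h₀|`, and the response is `≥ 0`, so `C' = C + c·a/U₀ + c|log h₀|` absorbs
both. [folklore] -/
theorem twSourcedCondensation_iff_core :
    TwSourcedCondensation ↔
      ∀ μ₁ μ₂ : ℝ, -4 < μ₁ → μ₁ ≤ μ₂ → μ₂ < 0 → ∃ a c C : ℝ, 0 < a ∧ 0 < c ∧ 0 < C ∧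
        ∀ U : ℝ, 0 < U → ∀ β : ℝ, 1 ≤ β → β ≤ Real.exp (a / U) → ∀ μ ∈ Set.Icc μ₁ μ₂,
          ∃ L₀ : ℕ, ∀ (L : ℕ) [NeZero L], L₀ ≤ L → ∀ h : ℝ,
            c * h ^ 2 * Real.log (1 / (|h| + 1 / β)) - C * h ^ 2 ≤
              Real.log (partitionFn β (dWaveSourceTorus L U μ h)).re / (β * (L : ℝ) ^ 2) -
                Real.log (partitionFn β (dWaveSourceTorus L U μ 0)).re / (β * (L : ℝ) ^ 2) := by
  unfold TwSourcedCondensation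
  constructor
  · intro H μ₁ μ₂ h1 h2 h3
    obtain ⟨U₀, a, c, C, h₀, hU₀, ha, hc, hC, hh₀, H⟩ := H μ₁ μ₂ h1 h2 h3
    refine ⟨a, c, C + c * (a / U₀) + c * |Real.log h₀|, ha, hc, by positivity, ?_⟩
    intro U hU β hβ1 hβa μ hμ
    have hβ : 0 < β := by linarith
    by_cases hUU : U ≤ U₀
    · obtain ⟨L₀, hL₀⟩ := H U hU hUU β hβ1 hβa μ hμ
      refine ⟨L₀, fun L _ hL h => ?_⟩
      have e1 : 0 ≤ c * (a / U₀) * h ^ 2 := by positivity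
      have e2 : 0 ≤ c * |Real.log h₀| * h ^ 2 := by positivity
      by_cases hh : |h| ≤ h₀
      · have := hL₀ L hL h hh
        nlinarith
      · push Not at hh
        have hlog := log_cutoff_le_of_lt hβ hh₀ hh
        have hR := pressure_response_nonneg L hβ.le U μ h
        have e3 : c * h ^ 2 * Real.log (1 / (|h| + 1 / β)) ≤ c * h ^ 2 * |Real.log h₀| :=
          mul_le_mul_of_nonneg_left hlog (by positivity)
        have e4 : 0 ≤ C * h ^ 2 := by positivity
        nlinarith
    · push Not at hUU
      refine ⟨0, fun L _ _ h => ?_⟩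
      have hlog : Real.log (1 / (|h| + 1 / β)) ≤ a / U₀ := by
        calc Real.log (1 / (|h| + 1 / β)) ≤ Real.log β := log_cutoff_le_log hβ h
          _ ≤ a / U := by rw [← Real.log_exp (a / U)]; exact Real.log_le_log hβ hβa
          _ ≤ a / U₀ := div_le_div_of_nonneg_left ha.le hU₀ hUU.le
      have hR := pressure_response_nonneg L hβ.le U μ h
      have e2 : 0 ≤ c * |Real.log h₀| * h ^ 2 := by positivity
      have e3 : c * h ^ 2 * Real.log (1 / (|h| + 1 / β)) ≤ c * h ^ 2 * (a / U₀) :=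
        mul_le_mul_of_nonneg_left hlog (by positivity)
      have e4 : 0 ≤ C * h ^ 2 := by positivity
      nlinarith
  · intro H μ₁ μ₂ h1 h2 h3
    obtain ⟨a, c, C, ha, hc, hC, H⟩ := H μ₁ μ₂ h1 h2 h3
    refine ⟨1, a, c, C, 1, one_pos, ha, hc, hC, one_pos, fun U hU _ β hβ1 hβa μ hμ => ?_⟩
    obtain ⟨L₀, hL₀⟩ := H U hU β hβ1 hβa μ hμ
    exact ⟨L₀, fun L _ hL h _ => hL₀ L hL h⟩

/-! ### Only positive sources matter -/

/-- **`TwSourcedCondensation` ↔ its restriction to `0 < h ≤ h₀`** (evenness of `Z_β(H_{L,h})` in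
`h`, gauge rotation by `e^{iπ/2}`; `h = 0` is an equality). [folklore] -/
theorem twSourcedCondensation_iff_pos :
    TwSourcedCondensation ↔
      ∀ μ₁ μ₂ : ℝ, -4 < μ₁ → μ₁ ≤ μ₂ → μ₂ < 0 → ∃ U₀ a c C h₀ : ℝ, 0 < U₀ ∧ 0 < a ∧ 0 < c ∧ 0 < C ∧
        0 < h₀ ∧ ∀ U : ℝ, 0 < U → U ≤ U₀ → ∀ β : ℝ, 1 ≤ β → β ≤ Real.exp (a / U) →
        ∀ μ ∈ Set.Icc μ₁ μ₂, ∃ L₀ : ℕ, ∀ (L : ℕ) [NeZero L], L₀ ≤ L → ∀ h : ℝ, 0 < h → h ≤ h₀ →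
          c * h ^ 2 * Real.log (1 / (|h| + 1 / β)) - C * h ^ 2 ≤
            Real.log (partitionFn β (dWaveSourceTorus L U μ h)).re / (β * (L : ℝ) ^ 2) -
              Real.log (partitionFn β (dWaveSourceTorus L U μ 0)).re / (β * (L : ℝ) ^ 2) := by
  unfold TwSourcedCondensation
  constructor
  · intro H μ₁ μ₂ h1 h2 h3
    obtain ⟨U₀, a, c, C, h₀, hU₀, ha, hc, hC, hh₀, H⟩ := H μ₁ μ₂ h1 h2 h3
    refine ⟨U₀, a, c, C, h₀, hU₀, ha, hc, hC, hh₀, fun U hU hUU β hβ1 hβa μ hμ => ?_⟩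
    obtain ⟨L₀, hL₀⟩ := H U hU hUU β hβ1 hβa μ hμ
    exact ⟨L₀, fun L _ hL h hh hhh => hL₀ L hL h (by rwa [abs_of_pos hh])⟩
  · intro H μ₁ μ₂ h1 h2 h3
    obtain ⟨U₀, a, c, C, h₀, hU₀, ha, hc, hC, hh₀, H⟩ := H μ₁ μ₂ h1 h2 h3
    refine ⟨U₀, a, c, C, h₀, hU₀, ha, hc, hC, hh₀, fun U hU hUU β hβ1 hβa μ hμ => ?_⟩
    obtain ⟨L₀, hL₀⟩ := H U hU hUU β hβ1 hβa μ hμ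
    refine ⟨L₀, fun L _ hL h hh => ?_⟩
    rcases lt_trichotomy h 0 with hneg | rfl | hpos
    · have := hL₀ L hL (-h) (neg_pos.2 hneg) (by rwa [abs_of_neg hneg] at hh)
      rwa [abs_neg, neg_sq, partitionFn_dWaveSourceTorus_neg] at this
    · simp
    · exact hL₀ L hL h hpos (by rwa [abs_of_pos hpos] at hh)

/-! ### All content is in `0 < c` -/

/-- With the Cooper-logarithm coefficient set to `0` the inequality of the crux holds trivially for
ALL `β > 0`, `L ≥ 1`, `U, μ, h`, `C ≥ 0` (the response is `≥ 0`). [folklore] -/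
theorem twSourcedCondensation_shape_at_c_zero (β : ℝ) (hβ : 0 < β) (L : ℕ) [NeZero L]
    (U μ h C : ℝ) (hC : 0 ≤ C) :
    0 * h ^ 2 * Real.log (1 / (|h| + 1 / β)) - C * h ^ 2 ≤
      Real.log (partitionFn β (dWaveSourceTorus L U μ h)).re / (β * (L : ℝ) ^ 2) -
        Real.log (partitionFn β (dWaveSourceTorus L U μ 0)).re / (β * (L : ℝ) ^ 2) := by
  have := pressure_response_nonneg L hβ.le U μ h
  nlinarith [sq_nonneg h]

/-! ### The threshold cannot be frozen at a gapped cluster -/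

/-- **A frozen threshold is impossible at a gapped cluster.** HYPOTHESIS (finite-dimensional, explicit):
for the side `ℓ` and a chemical potential `μs ∈ (-4,0)` there are `γ, U₁ > 0` such that for every
`0 < U ≤ U₁` the cluster Hamiltonian `K₀ = hubbardTorusWith 2 ℓ 1 U μs` has a unit vector `ψ₀` with
`K₀ ≥ E₀(K₀) + γ(1 - |ψ₀⟩⟨ψ₀|)` (unique gapped ground state) and `⟨ψ₀,(Δ_d + Δ_d†)ψ₀⟩ = 0` (definite
particle number). CONCLUSION: the crux with `∃ L₀` replaced by the frozen `L₀ := ℓ` is FALSE —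
witness `μ₁ = μ₂ = μs`, `L = ℓ`, `β = e^{a/U}`, `h = e^{-a/(2U)}` (`βh² = 1`): the response is
`≤ (‖Q‖²/(γℓ²) + log dim/ℓ²) h²` (`log_partitionFn_source_sub_le_of_gap`) while the floor is
`h²(c(a/(2U) - log 2) - C)`. Hence `L₀(U,β,μ) → ∞` as `β → ∞` is forced at non-resonant `μ`. [folklore] -/
theorem twSourcedCondensation_false_frozenThreshold_of_gap (ℓ : ℕ) [NeZero ℓ] {μs γ U₁ : ℝ}
    (hμ1 : -4 < μs) (hμ2 : μs < 0) (hγ : 0 < γ) (hU₁ : 0 < U₁)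
    (hyp : ∀ U : ℝ, 0 < U → U ≤ U₁ → ∃ ψ₀ : Fock (Orb (FermionTorus 2 ℓ)),
      star ψ₀ ⬝ᵥ ψ₀ = 1 ∧
      star ψ₀ ⬝ᵥ (pairField dWaveFormFactor ℓ + (pairField dWaveFormFactor ℓ)ᴴ) *ᵥ ψ₀ = 0 ∧
      ∀ φ : Fock (Orb (FermionTorus 2 ℓ)), star φ ⬝ᵥ φ = 1 →
        (hubbardTorusWith 2 ℓ 1 U μs).groundEnergy + γ * (1 - ‖star ψ₀ ⬝ᵥ φ‖ ^ 2) ≤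
          (star φ ⬝ᵥ (hubbardTorusWith 2 ℓ 1 U μs) *ᵥ φ).re) :
    ¬ (∀ μ₁ μ₂ : ℝ, -4 < μ₁ → μ₁ ≤ μ₂ → μ₂ < 0 → ∃ U₀ a c C h₀ : ℝ, 0 < U₀ ∧ 0 < a ∧ 0 < c ∧ 0 < C ∧
      0 < h₀ ∧ ∀ U : ℝ, 0 < U → U ≤ U₀ → ∀ β : ℝ, 1 ≤ β → β ≤ Real.exp (a / U) →
      ∀ μ ∈ Set.Icc μ₁ μ₂, ∀ (L : ℕ) [NeZero L], ℓ ≤ L → ∀ h : ℝ, |h| ≤ h₀ →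
        c * h ^ 2 * Real.log (1 / (|h| + 1 / β)) - C * h ^ 2 ≤
          Real.log (partitionFn β (dWaveSourceTorus L U μ h)).re / (β * (L : ℝ) ^ 2) -
            Real.log (partitionFn β (dWaveSourceTorus L U μ 0)).re / (β * (L : ℝ) ^ 2)) := by
  intro H
  obtain ⟨U₀, a, c, C, h₀, hU₀, ha, hc, hC, hh₀, H⟩ := H μs μs hμ1 le_rfl hμ2
  set Q := pairField dWaveFormFactor ℓ + (pairField dWaveFormFactor ℓ)ᴴ with hQdef
  have hℓ : (0 : ℝ) < (ℓ : ℝ) ^ 2 := cast_sq_pos_of_neZero ℓ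
  set A : ℝ := ‖Q‖ ^ 2 / (γ * (ℓ : ℝ) ^ 2) with hA
  set B : ℝ := Real.log (Fintype.card (Finset (Orb (FermionTorus 2 ℓ)))) / (ℓ : ℝ) ^ 2 with hB
  have hA0 : 0 ≤ A := by positivity
  have hlogD : 0 ≤ Real.log (Fintype.card (Finset (Orb (FermionTorus 2 ℓ)))) :=
    Real.log_nonneg (by exact_mod_cast Nat.one_le_iff_ne_zero.2 Fintype.card_ne_zero)
  have hB0 : 0 ≤ B := div_nonneg hlogD hℓ.le
  have hlog2 : 0 < Real.log 2 := Real.log_pos one_lt_two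
  have hsum : 0 ≤ A + B + C + c * Real.log 2 := by nlinarith
  set M : ℝ := 2 * (A + B + C + c * Real.log 2) / c + 2 * |Real.log h₀| + 1 with hM
  have hMpos : 0 < M := by
    have : 0 ≤ 2 * (A + B + C + c * Real.log 2) / c := by positivity
    positivity
  obtain ⟨U, hUpos, hUle, haU⟩ := exists_small_coupling (lt_min hU₀ hU₁) ha hMpos
  set β : ℝ := Real.exp (a / U) with hβ
  have hβpos : 0 < β := Real.exp_pos _
  have hβ1 : 1 ≤ β := Real.one_le_exp (div_nonneg ha.le hUpos.le)
  set h : ℝ := Real.exp (-(a / U) / 2) with hh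
  have hhpos : 0 < h := Real.exp_pos _
  have haU0 : 0 ≤ a / U := div_nonneg ha.le hUpos.le
  have hhle : h ≤ 1 := Real.exp_le_one_iff.2 (by linarith)
  have hh2 : h ^ 2 * β = 1 := by
    rw [hh, hβ, sq, ← Real.exp_add, ← Real.exp_add, show -(a / U) / 2 + -(a / U) / 2 + a / U = 0 by ring,
      Real.exp_zero]
  have hβinv : 1 / β = h ^ 2 := by
    rw [eq_comm, eq_div_iff hβpos.ne']; exact hh2
  have hhh₀ : |h| ≤ h₀ := by
    rw [abs_of_pos hhpos, hh, ← Real.le_log_iff_exp_le hh₀]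
    have : -|Real.log h₀| ≤ Real.log h₀ := neg_abs_le _
    have h2 : 2 * |Real.log h₀| ≤ a / U := by
      have : 0 ≤ 2 * (A + B + C + c * Real.log 2) / c := by positivity
      linarith
    linarith
  have key := H U hUpos (hUle.trans (min_le_left _ _)) β hβ1 le_rfl μs ⟨le_rfl, le_rfl⟩ ℓ le_rfl h hhh₀
  obtain ⟨ψ₀, hψ₀, hψQ, hgap⟩ := hyp U hUpos (hUle.trans (min_le_right _ _))
  have hK := isHermitian_hubbardTorusWith ℓ 1 U μs
  have hQh : Q.IsHermitian := isHermitian_pairField_add_conjTranspose ℓ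
  have bound := log_partitionFn_source_sub_le_of_gap hK hQh hψ₀ hγ hgap hψQ hβpos.le h
  have hden : 0 < β * (ℓ : ℝ) ^ 2 := mul_pos hβpos hℓ
  have hR : Real.log (partitionFn β (dWaveSourceTorus ℓ U μs h)).re / (β * (ℓ : ℝ) ^ 2) -
      Real.log (partitionFn β (dWaveSourceTorus ℓ U μs 0)).re / (β * (ℓ : ℝ) ^ 2) ≤ (A + B) * h ^ 2 := by
    rw [← sub_div, div_le_iff₀ hden, dWaveSourceTorus_zero]
    change Real.log (partitionFn β (hubbardTorusWith 2 ℓ 1 U μs - (h : ℂ) • Q)).re -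
        Real.log (partitionFn β (hubbardTorusWith 2 ℓ 1 U μs)).re ≤ _
    refine bound.trans (le_of_eq ?_)
    have hℓ0 : (ℓ : ℝ) ≠ 0 := by exact_mod_cast NeZero.ne ℓ
    have e1 : β * (h ^ 2 * ‖Q‖ ^ 2 / γ) = A * h ^ 2 * (β * (ℓ : ℝ) ^ 2) := by
      rw [hA]; field_simp
    have e2 : Real.log (Fintype.card (Finset (Orb (FermionTorus 2 ℓ)))) = B * h ^ 2 * (β * (ℓ : ℝ) ^ 2) := by
      rw [hB]
      calc Real.log (Fintype.card (Finset (Orb (FermionTorus 2 ℓ))))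
          = Real.log (Fintype.card (Finset (Orb (FermionTorus 2 ℓ)))) / (ℓ : ℝ) ^ 2 * (h ^ 2 * β) *
              (ℓ : ℝ) ^ 2 := by rw [hh2, mul_one, div_mul_cancel₀ _ hℓ.ne']
        _ = _ := by ring
    rw [e1, e2]; ring
  have hlog : a / U / 2 - Real.log 2 ≤ Real.log (1 / (|h| + 1 / β)) := by
    rw [abs_of_pos hhpos, hβinv]
    have hsum' : h + h ^ 2 ≤ 2 * h := by nlinarith
    have hpos' : 0 < h + h ^ 2 := by positivity
    calc a / U / 2 - Real.log 2 = Real.log (1 / (2 * h)) := by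
          rw [one_div, Real.log_inv, Real.log_mul two_ne_zero hhpos.ne', hh, Real.log_exp]; ring
      _ ≤ Real.log (1 / (h + h ^ 2)) :=
          Real.log_le_log (by positivity) (one_div_le_one_div_of_le hpos' hsum')
  have hh2pos : 0 < h ^ 2 := by positivity
  have step : c * h ^ 2 * (a / U / 2 - Real.log 2) - C * h ^ 2 ≤ (A + B) * h ^ 2 := by
    have := mul_le_mul_of_nonneg_left hlog (le_of_lt (mul_pos hc hh2pos))
    linarith
  have step2 : c * (a / U / 2 - Real.log 2) - C ≤ A + B := by
    by_contra hcon
    push Not at hcon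
    have := mul_lt_mul_of_pos_left hcon hh2pos
    linarith
  have hM2 : 2 * (A + B + C + c * Real.log 2) / c + 1 ≤ a / U := by
    linarith [abs_nonneg (Real.log h₀)]
  have hM3 : 2 * (A + B + C + c * Real.log 2) + c ≤ c * (a / U) := by
    have e : c * (2 * (A + B + C + c * Real.log 2) / c + 1) = 2 * (A + B + C + c * Real.log 2) + c := by
      field_simp
    rw [← e]
    exact mul_le_mul_of_nonneg_left hM2 hc.le
  linarith

end Summit.HubbardSuperconductivity.HubbardSuperconductivity.Theorems.TwSourcedCondensation.Negative
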